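import Literature.AnabelianGeometry.EtaleTheta.GalSectSplittingsTransportH1
import HarnessLib

/-!
# [GalSect] §4: the `H¹`-torsor structure at a cusp is CANONICAL (independent of the base splitting), and the
# curve-level corollaries of the functoriality (proof-only)

S. Mochizuki, *Galois sections in absolute anabelian geometry* [GalSect], Nagoya Math. J. **179** (2005), §4
p.33 [cite: MochizukiGalSect2005, §4 p.33]; Brown, *Cohomology of Groups*, Ch. IV §2
[cite: Brown1982CohomologyGroups, Ch. IV §2 Prop. 2.1 and Prop. 2.3].  abc-iut cell, layer L2, seat
abc-iut-w5-d062 (gen 3), sequel (D) of the row «O1-(b2) at the genuine torsor».  PROOF-ONLY: 0 defs.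

abc-iut-w5-d029's `CuspPair.torsorDataH1 hD hI hS₀` is built from a CHOSEN base splitting `S₀` (the
identification `[S] ↦ [π_{S₀}]⁻¹·[π_S]` with `Ker(res)`).  Print's torsor is intrinsic.  Here:

* `TorsorData.ext_act` — torsor data are determined by their action;
* `splittingClassEquivResKer_change_base` — changing the base multiplies the identification by the constant
  `[π_{S₁}]⁻¹·[π_{S₀}]`;
* **`torsorDataH1_base_indep`** — `P.torsorDataH1 hD hI hS₀ = P.torsorDataH1 hD hI hS₁`: the ACTION of
  `Ker(res) ⊆ H¹(D, I)` on splitting classes does not depend on the base (the structure group is abelian);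
* **`TemperedCurve.cuspTorsorH1_base_indep`** and **`TemperedCurve.exists_cuspTorsorH1_equivariant`** — the same
  at a cusp of a tempered curve of L3's interface, and the functoriality of FILE (B) read at two curves
  `X`, `X'` and an isomorphism `Γ : Π^tp_X ≃ Π^tp_{X'}` carrying `(D_x, I_x)` onto `(D_{x'}, I_{x'})`.

HONEST FRAMING: interface-level group theory; [GalSect] refereed; nothing here bears on [IUTchIII] Cor. 3.12;
typed ≠ proved for anything of [EtTh].
-/

noncomputable section

namespace Literature.AnabelianGeometry.EtaleTheta

open scoped Pointwise

namespace GalSect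

namespace CuspPair

variable {G : Type*} [Group G] [TopologicalSpace G]

/-- Torsor data are determined by their action. [cite: MochizukiGalSect2005, §4 p.33] -/
theorem TorsorData.ext_act {P : CuspPair G} {A : Type*} [Group A] {T T' : P.TorsorData A}
    (h : ∀ a c, T.act a c = T'.act a c) : T = T' := by
  obtain ⟨act, h1, h2, h3⟩ := T
  obtain ⟨act', h1', h2', h3'⟩ := T'
  have : act = act' := funext fun a => funext fun c => h a c
  subst this
  rfl

variable [IsTopologicalGroup G] [T1Space G] (P : CuspPair G) [IsMulCommutative P.I]

/-- **Change of base**: the identifications with `Ker(res)` through two base splittings `S₀`, `S₁` differ by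
the constant `[π_{S₁}]⁻¹·[π_{S₀}]`. [cite: MochizukiGalSect2005, §4 p.33] -/
theorem splittingClassEquivResKer_change_base (hD : IsClosed (P.D : Set G)) (hI : IsCompact (P.I : Set G))
    {S₀ S₁ : Subgroup G} (hS₀ : S₀ ∈ P.splittings) (hS₁ : S₁ ∈ P.splittings) (c : P.SplittingClass) :
    haveI := P.ID_normal
    ((P.splittingClassEquivResKer hD hI hS₁ c : _) : ContH1 (MonoidHom.id P.D) P.ID ⊤) =
      ((P.isClosedComplement_of_mem_splittings hS₁).classOf (P.isCompact_ID hI))⁻¹ *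
        (P.isClosedComplement_of_mem_splittings hS₀).classOf (P.isCompact_ID hI) *
          ((P.splittingClassEquivResKer hD hI hS₀ c : _) : ContH1 (MonoidHom.id P.D) P.ID ⊤) := by
  obtain ⟨S, hS, rfl⟩ := SplittingClass.exists_rep P c
  rw [splittingClassEquivResKer_mk_coe, splittingClassEquivResKer_mk_coe, mul_assoc, mul_inv_cancel_left]

/-- **The `H¹`-torsor structure is CANONICAL**: the action of `Ker(res)` on the splitting classes does not
depend on the base splitting used to construct it. [cite: MochizukiGalSect2005, §4 p.33] -/
theorem torsorDataH1_base_indep (hD : IsClosed (P.D : Set G)) (hI : IsCompact (P.I : Set G))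
    {S₀ S₁ : Subgroup G} (hS₀ : S₀ ∈ P.splittings) (hS₁ : S₁ ∈ P.splittings) :
    P.torsorDataH1 hD hI hS₀ = P.torsorDataH1 hD hI hS₁ := by
  haveI := P.ID_normal
  apply TorsorData.ext_act
  intro k c
  set E₀ := P.splittingClassEquivResKer hD hI hS₀ with hE₀
  set E₁ := P.splittingClassEquivResKer hD hI hS₁ with hE₁
  have hL : (P.torsorDataH1 hD hI hS₀).act k c = E₀.symm (k * E₀ c) := rfl
  have hR : (P.torsorDataH1 hD hI hS₁).act k c = E₁.symm (k * E₁ c) := rfl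
  rw [hL, hR]
  apply E₁.injective
  rw [Equiv.apply_symm_apply]
  apply Subtype.ext
  rw [hE₁, hE₀, P.splittingClassEquivResKer_change_base hD hI hS₀ hS₁, Equiv.apply_symm_apply, Subgroup.coe_mul,
    Subgroup.coe_mul, P.splittingClassEquivResKer_change_base hD hI hS₀ hS₁ c]
  -- abelian bookkeeping in `H¹(D, I)`
  rw [mul_left_comm]

end CuspPair

end GalSect

end Literature.AnabelianGeometry.EtaleTheta

/-! ### At a cusp of a tempered curve -/

namespace Literature.AnabelianGeometry.SemiGraphs.TemperedCurve

open Literature.AnabelianGeometry.EtaleTheta Literature.AnabelianGeometry.EtaleTheta.GalSect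

variable {p : ℕ} [Fact p.Prime]

/-- **The §4 torsor at a cusp of a tempered curve is canonical** (base-independent).
[cite: MochizukiGalSect2005, §4 p.33] -/
theorem cuspTorsorH1_base_indep (X : TemperedCurve p) [T1Space X.PiTemp] {x : X.Pt} (hx : X.IsCusp x)
    {S₀ S₁ : Subgroup X.PiTemp} (hS₀ : S₀ ∈ (cuspPairOf X x).splittings)
    (hS₁ : S₁ ∈ (cuspPairOf X x).splittings) :
    X.cuspTorsorH1 hx hS₀ = X.cuspTorsorH1 hx hS₁ :=
  haveI : IsMulCommutative (cuspPairOf X x).I := X.isMulCommutative_inertia hx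
  (cuspPairOf X x).torsorDataH1_base_indep (X.isClosed_decomp x) (X.isCompact_inertia hx) hS₀ hS₁

/-- **Functoriality at cusps of tempered curves** (FILE (B) read at `P = (D_x, I_x)`, `P' = (D_{x'}, I_{x'})`):
for an isomorphism `Γ : Π^tp_X ≃ Π^tp_{X'}` carrying `(D_x, I_x)` onto `(D_{x'}, I_{x'})` and the class
transport `e` (`e [S] = [Γ S]`), there is an isomorphism `φ` of the cohomological structure groups with
`e (k • c) = φ(k) • e(c)`. [cite: MochizukiGalSect2005, §4 p.33] -/
theorem exists_cuspTorsorH1_equivariant (X X' : TemperedCurve p) [T1Space X.PiTemp] [T1Space X'.PiTemp]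
    {x : X.Pt} (hx : X.IsCusp x) {x' : X'.Pt} (hx' : X'.IsCusp x') {Γ : X.PiTemp ≃ₜ* X'.PiTemp}
    (hpair : (cuspPairOf X x).map Γ = cuspPairOf X' x')
    {S₀ : Subgroup X.PiTemp} (hS₀ : S₀ ∈ (cuspPairOf X x).splittings)
    (hS₀' : S₀.map Γ.toMulEquiv.toMonoidHom ∈ (cuspPairOf X' x').splittings)
    {e : (cuspPairOf X x).SplittingClass → (cuspPairOf X' x').SplittingClass}
    (he : ∀ (S : Subgroup X.PiTemp) (hS : S ∈ (cuspPairOf X x).splittings),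
      ∃ h', e (CuspPair.SplittingClass.mk _ S hS) =
        CuspPair.SplittingClass.mk _ (S.map Γ.toMulEquiv.toMonoidHom) h') :
    haveI : IsMulCommutative (cuspPairOf X x).I := X.isMulCommutative_inertia hx
    haveI : IsMulCommutative (cuspPairOf X' x').I := X'.isMulCommutative_inertia hx'
    haveI := (cuspPairOf X x).ID_normal
    haveI := (cuspPairOf X' x').ID_normal
    ∃ φ : ContH1.resKer (cuspPairOf X x).ID (⊤ : Subgroup (cuspPairOf X x).D)
          ((cuspPairOf X x).isClosedComplement_of_mem_splittings hS₀).le_left ≃*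
        ContH1.resKer (cuspPairOf X' x').ID (⊤ : Subgroup (cuspPairOf X' x').D)
          ((cuspPairOf X' x').isClosedComplement_of_mem_splittings hS₀').le_left,
      ∀ k c, e ((X.cuspTorsorH1 hx hS₀).act k c) = (X'.cuspTorsorH1 hx' hS₀').act (φ k) (e c) :=
  haveI : IsMulCommutative (cuspPairOf X x).I := X.isMulCommutative_inertia hx
  haveI : IsMulCommutative (cuspPairOf X' x').I := X'.isMulCommutative_inertia hx'
  CuspPair.exists_torsorDataH1_equivariant hpair (X.isClosed_decomp x) (X.isCompact_inertia hx)
    (X'.isClosed_decomp x') (X'.isCompact_inertia hx') hS₀ hS₀' he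

end Literature.AnabelianGeometry.SemiGraphs.TemperedCurve

end
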